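import Summits.QuantumFields.BalabanUV.T4Continuum.Support.VariationalColourTaxiTowerCentred
import Summits.QuantumFields.BalabanUV.T4Continuum.Support.VariationalColourTaxiTowerColourLeaves
import Summits.QuantumFields.BalabanUV.T4Continuum.Support.VariationalColourTaxiTowerProjGRegularRate

/-!
# T⁴ programme, spine node NE2 (U1a), lane P2 — THE VECTOR END AT BAŁABAN's TAXI DATA WITH (ONE-min) DISCHARGED: EXISTENCE OF THE TOWER LIMIT for Bałaban's covariant
# projected gauge functional ⇐ the plaquette class + the uniform (GF3) + the DECAY OF AN EXPLICIT SEQUENCE (item «ONE-MIN AT TAXI DATA — THE COMPOSITE-FIBRE ↔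
# TAXI-FRAME BRIDGE», file 8 = the END corollary; model level; cell `pub-balaban`)

NE2 formalisation swarm `b2b-balaban-t4-ne2-formalise-*`, leaf prover 04 GEN 7 (`prover-b2b-balaban-t4-ne2-formalise-leaf-04-g7-0`); register row «P2-sup» of
`t4/formal/NE2/LEAVES.md`; journal CLAIMS.log INTENT 2026-08-20 l.21025, courier LANDED l.22267.  Composition BY NAME, pattern of part 6's `effV_tendsto_taxiTower_projG_of_class`
(p229644) and leaf-01-g9's `VariationalVectorEndCentred.effV_tendsto_centred_geom`: leaf-10-g3's monotone END `VariationalVectorEndMonotone.effV_tendsto_of_upper_geom` with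
`ρV k := ScV + nsqV∘Q_k` (V-REG for it TRIVIAL, `C_R = 1`), coarse V-UB ∕ V-P ∕ V-REG from part 8's `projG_sockets_nestLv` (p233166), the class package (part 4's
`taxiClassPackage` + part 2's class arithmetic), and `hONEm k :=` THIS item's courier `VariationalColourTaxiTowerCentred.hONEm_taxi` (p238755) fed by file 7's
`colour_leaves_taxi` (p238840).  Nothing defined.

THE STATEMENT ([folklore]; `E = ℂ`).  **`effV_tendsto_taxiTower_projG_centred`**: `2 ≤ L`, `1 ≤ d`, `1 < M_μ`; a COHERENT tower of UNITARY one-step bonds in the class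
`(L^{k+1})²b_k ≤ c`, `0 ≤ b_k`; polynomial smallness of `c` (part 2's four lines + `64d((d−1)c)² ≤ ½` (colour FED⁺ absorption) + `60·6^{d−1}(2((d−1)+d²) + 5(d−1))c < 1`
(file 5's near-frame V-UB)); the uniform (GF3) `hGdiv` for the straight-taxi kernels (part 6's letter; part 7 supplies it under the regular presentation); free positive
parameters `s, t, u, u₂, w : ℕ → ℝ`; and — DISPLAYED, about EXPLICIT sequences of the class (the `let`s below, functions of a plaquette-class sequence `a` of the level
bonds and of `k`) — the two transfer smallness lines `v a k ≤ ⅛`, `γ k ≤ ¼` and the geometric decay `ε₁ a k ≤ c_ε θ^k`, `δ₁ a k ≤ c_δ θ^k` for EVERY class sequence `a`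
(`0 ≤ a_k`, `(L^k)²a_k ≤ c`).  CONCLUSION = part 6's verbatim: the effective operators `effV (L^k) M (Rlev k) (GmProj …) (QmL (L^k) M (nestLv k)) aa` converge to a Hermitian limit
with nonnegative form and the block-spin values converge.
HONEST, UP FRONT.  Compared with parts 6 ∕ 7 the (ONE-min) binder `hONEm` is GONE (a theorem: leaf-01-g9's centred competitor + this item's bridge); what is displayed instead is
PURE ARITHMETIC about explicit sequences (their decay is the class bookkeeping `ε⋆_k = O(θ^k)` — leaf-01's announced `epsStar_class_le` — plus `δ_k², γ₀,k² → 0`), and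
(GF3).  NOT Bałaban's (1.90) as printed; model level (c5); thresholds quantitatively void.

HONEST FRAMING (T4-DAG p. 1).  Rung (B)+1 only — NOT infinite volume, NOT a mass gap, NOT Clay.  NE2 NOT IN PRINT, NOT proved here.  MODEL LEVEL (c5): bond operators DATA,
taxi contours, carriers, gauge fixing and competitor OURS; composition of landed leaves ([folklore]); nothing printed is a hypothesis; no `def`, no `def … : Prop`, no `sorry`;
axioms standard.  V-END with background NOT proved unconditionally ((GF3) + the decay lines displayed); NE2 NOT proved; NE3 OPEN; spine PROVED 0∕9 unchanged.  HONEST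
DEPENDENCY (cell, verbatim): continuum YM on T⁴ ⇐ BetaPertH ∧ nine spine estimates (0/9 proved); BetaPertH ⇐ (D1) ∧ (D4) ∧ CAP+tail; G-an2-4 gates asym, D1 and NE2/3/4.
-/

noncomputable section

namespace Summit.QuantumFields.BalabanUV.T4Continuum.VariationalColourTaxiTransport

open Finset Filter
open scoped Matrix ComplexOrder BigOperators Topology
open Literature.MathematicalPhysics.QuantumFieldTheory.Balaban1983to89.B5Prop11Plancherel (Tor fine unitVec)
open Literature.MathematicalPhysics.QuantumFieldTheory.Balaban1983to89.B5Composition116 (sites)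
open Literature.Analysis.Complex (qform)
open Summit.QuantumFields.BalabanUV.T4Continuum.VariationalTransfer (blockSpin)
open Summit.QuantumFields.BalabanUV.T4Continuum.VariationalColourFederbush (norm_le_one_of_mem_unitary)
open Summit.QuantumFields.BalabanUV.T4Continuum.VariationalColourTower (Rtrv)
open Summit.QuantumFields.BalabanUV.T4Continuum.VariationalColourUpperBound (nsqv)
open Summit.QuantumFields.BalabanUV.T4Continuum.VariationalVectorFederbush (lineT)
open Summit.QuantumFields.BalabanUV.T4Continuum.VectorBlockTrialForm (nsqV nsqV_nonneg QvL roughV kappaV kappaV_pos)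
open Summit.QuantumFields.BalabanUV.T4Continuum.VariationalVectorForm (ScV SfV qWV lamV lamV_nonneg ScV_nonneg)
open Summit.QuantumFields.BalabanUV.T4Continuum.VariationalVectorEffective (unc effV)
open Summit.QuantumFields.BalabanUV.T4Continuum.VariationalVectorTower (Gtr QmL)
open Summit.QuantumFields.BalabanUV.T4Continuum.VariationalVectorWeitzenbock (divSq)
open Summit.QuantumFields.BalabanUV.T4Continuum.VariationalVectorGaugeSlice (avgOp projG projG_nonneg)
open Summit.QuantumFields.BalabanUV.T4Continuum.VariationalVectorGaugeSliceTower (Gtr_pullback)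
open Summit.QuantumFields.BalabanUV.T4Continuum.VariationalVectorRegularityCovariant (GmProj GmProj_posSemidef projG_eq_qform)
open Summit.QuantumFields.BalabanUV.T4Continuum.CovariantBlockReversePoincare (revPC revPC_nonneg)
open Summit.QuantumFields.BalabanUV.T4Continuum.VariationalVectorEndMonotone (effV_tendsto_of_upper_geom)
open Summit.QuantumFields.BalabanUV.T4Continuum.VariationalVectorOneMinCentredBracket (epsStar_nonneg)

variable {d : ℕ}
variable (L : ℕ) [NeZero L] (M : Fin d → ℕ) [hM : ∀ μ, NeZero (M μ)]

omit [NeZero L] hM in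
/-- arithmetic for the transfer constant: `1 ≤ (1 + w + (1+w⁻¹)x(1+4γ))(1+4v)(1+u)` for nonnegative `x, γ, v, u` and `0 < w`. [folklore] -/
theorem one_le_transferA {w x γ v u : ℝ} (hw : 0 < w) (hx : 0 ≤ x) (hγ : 0 ≤ γ) (hv : 0 ≤ v) (hu : 0 ≤ u) :
    1 ≤ (1 + w + (1 + w⁻¹) * x * (1 + 4 * γ)) * (1 + 4 * v) * (1 + u) := by
  have hwi : 0 ≤ w⁻¹ := inv_nonneg.mpr hw.le
  have h1 : 1 ≤ 1 + w + (1 + w⁻¹) * x * (1 + 4 * γ) := by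
    have : 0 ≤ (1 + w⁻¹) * x * (1 + 4 * γ) := by positivity
    linarith
  calc (1 : ℝ) = 1 * 1 * 1 := by ring
    _ ≤ (1 + w + (1 + w⁻¹) * x * (1 + 4 * γ)) * (1 + 4 * v) * (1 + u) :=
      mul_le_mul (mul_le_mul h1 (by linarith) zero_le_one (by linarith)) (by linarith) zero_le_one (by positivity)

/-- **EXISTENCE OF THE VECTOR TOWER LIMIT AT BAŁABAN's TAXI DATA FOR BAŁABAN's COVARIANT PROJECTED GAUGE FUNCTIONAL, (ONE-min) DISCHARGED** — see the module
docstring; displayed: the class, the uniform (GF3), and pure arithmetic on the explicit sequences `v, γ, ε₁, δ₁` below. [folklore] -/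
theorem effV_tendsto_taxiTower_projG_centred (hL : 2 ≤ L) (hd : 1 ≤ d) (hM2 : ∀ μ, 1 < M μ)
    {R' : (k : ℕ) → Tor (fine L (fine (L ^ k) M)) → Fin d → (ℂ →L[ℂ] ℂ)} (hU : ∀ k x μ, R' k x μ ∈ unitary (ℂ →L[ℂ] ℂ)) {b : ℕ → ℝ} {c : ℝ}
    (hb : ∀ k x κ ι, ‖R' k x κ * R' k (x + unitVec (fine L (fine (L ^ k) M)) κ) ι - R' k x ι * R' k (x + unitVec (fine L (fine (L ^ k) M)) ι) κ‖ ≤ b k)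
    (hb0 : ∀ k, 0 ≤ b k) (hbc : ∀ k, (((L ^ (k + 1) : ℕ)) : ℝ) ^ 2 * b k ≤ c)
    (hcoh : ∀ k, coarseTv L (fine (L ^ (k + 1)) M) (R' (k + 1)) = Rtrv (L ^ k) L M (R' k))
    -- the polynomial smallness of the class constant (part 2's four + two more)
    (hsm1 : 60 * (6 : ℝ) ^ (d - 1) * ((2 * ((((d - 1 : ℕ) : ℝ) + (d : ℝ) * d)) + 3 * ((d - 1 : ℕ) : ℝ)) * c) ≤ 1 / 2)
    (hsm2 : 2 * (d : ℝ) * ((((d - 1 : ℕ) : ℝ)) * c) ^ 2 ≤ 1 / 2) (hsm3 : 64 * (2 * ((((d - 1 : ℕ) : ℝ) + (d : ℝ) * d) * c)) ^ 2 ≤ 1)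
    (hsm4 : 80 * ((d : ℝ) * c) ≤ 1) (hsm5 : 64 * (d : ℝ) * ((((d - 1 : ℕ) : ℝ)) * c) ^ 2 ≤ 1 / 2)
    (hsm6 : 60 * (6 : ℝ) ^ (d - 1) * ((2 * ((((d - 1 : ℕ) : ℝ) + (d : ℝ) * d)) + 5 * ((d - 1 : ℕ) : ℝ)) * c) < 1)
    -- the DISPLAYED uniform (GF3) for the straight-taxi kernels
    {CDs CDs' : ℝ} (hCDs0 : 0 ≤ CDs) (hCDs0' : 0 ≤ CDs')
    (hGdiv : ∀ k W, ((((L ^ k : ℕ) : ℝ)) ^ d)⁻¹ * ((((L ^ k : ℕ) : ℝ)) ^ 2 * divSq (fine (L ^ k) M) (Rlev L M R' k) W)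
      ≤ CDs * ScV (L ^ k) M (Rlev L M R' k) (projG (fine (L ^ k) M) (Rlev L M R' k) (LinearMap.ker (avgOp (L ^ k) M (taxiTv (L ^ k) M (Rlev L M R' k))))) W
        + CDs' * nsqV M (QvL (L ^ k) M (nestLv L M R' k) W))
    -- the effective-operator parameter, the decay rate, the free parameters
    {aa : ℝ} (haa : 0 < aa) {θ : ℝ} (hθ : 0 ≤ θ) (hθ1 : θ < 1)
    (s t u u₂ w : ℕ → ℝ) (hs : ∀ k, 0 < s k) (ht : ∀ k, 0 < t k) (hu : ∀ k, 0 < u k) (hu₂ : ∀ k, 0 < u₂ k) (hw : ∀ k, 0 < w k) {cε cδ : ℝ} :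
    -- the colour scalar pair's constants at the taxi frames (file 7's lets, `C_P = 136`)
    let Λc : (ℕ → ℝ) → ℕ → ℝ := fun a k => 2 * d * (36 : ℝ) ^ d * ((1 + ((L ^ k : ℕ) : ℝ) * (((d - 1 : ℕ) : ℝ) * ((L ^ k - 1 : ℕ) : ℝ) * a k)) ^ 2 + 9)
    let CRc : (ℕ → ℝ) → ℕ → ℝ := fun a k => 2 * Λc a k + 2 * d * (a k * (((L ^ k : ℕ) : ℝ)) ^ 2) + (d : ℝ) ^ 2 * (a k * (((L ^ k : ℕ) : ℝ)) ^ 2) ^ 2 * 136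
    let ε₁c : ℕ → ℝ := fun k => ((d : ℝ) / 4 + 1 / 2) * ((L : ℝ) / (((L ^ k : ℕ) : ℝ)) ^ 2)
    let δ'c : ℕ → ℝ := fun k => Real.sqrt (2 * d * (1 + (d : ℝ) ^ 2)) * ((((L ^ k : ℕ) : ℝ)) * L * (((d - 1 : ℕ) : ℝ) * ((L - 1 : ℕ) : ℝ) * ((2 * L - 1 : ℕ) : ℝ) * b k))
    let Λcol : (ℕ → ℝ) → ℕ → ℝ := fun a k => Λc a k + (ε₁c k * CRc a k + 2 * δ'c k * Real.sqrt ((1 + ε₁c k * CRc a k) * 136) + δ'c k ^ 2 * 136) * (Λc a k + 1)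
    -- part 6 §1's V-P ∕ (Går) constants from the uniform (GF3), file 5's `Λᵥ`, part 8's V-REG constant
    let CPv : (ℕ → ℝ) → ℕ → ℝ := fun a k => max (40 * (2 * (1 + CDs))) (64 + 40 * (2 * (CDs' + d * ((((L ^ k : ℕ) : ℝ)) ^ 2 * a k) * 64)))
    let CGar' : (ℕ → ℝ) → ℕ → ℝ := fun a k => 2 * (CDs' + d * ((((L ^ k : ℕ) : ℝ)) ^ 2 * a k) * 64)
    let Λv : (ℕ → ℝ) → ℕ → ℝ := fun a k => lamV d ((L ^ k * L : ℕ) * (((d - 1 : ℕ) : ℝ) * ((L - 1 : ℕ) : ℝ) * ((2 * L - 1 : ℕ) : ℝ) * b k + ((d - 1 : ℕ) : ℝ) * ((L ^ k - 1 : ℕ) : ℝ) * a k)) d (((L ^ k * L : ℕ) : ℝ) ^ 2 * 0)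
          / (1 - (kappaV d (L ^ k * L))⁻¹ * ((∑ q ∈ Finset.range k, ((((d - 1 : ℕ) : ℝ) + (d : ℝ) * d) * (((L : ℝ) * ((L ^ q - 1 : ℕ) : ℝ) * ((L - 1 : ℕ) : ℝ)) * b q))) + 3 * (((d - 1 : ℕ) : ℝ) * (L ^ k : ℕ) * ((L ^ k - 1 : ℕ) : ℝ) * a k) + ((d - 1 : ℕ) : ℝ) * ((L ^ k - 1 : ℕ) : ℝ) * ((2 * L ^ k - 1 : ℕ) : ℝ) * a k)) ^ 2
    let CRv : ℝ := (8 * (4 * lamV d (((d - 1 : ℕ) : ℝ) * c) (d : ℝ) 0) + 2 * d * c * ((2 * (1 + CDs)) + (2 * (CDs' + (d : ℝ) * c * 64))) + (8 * (4 * d * 36 ^ d * (1 + ((d - 1 : ℕ) : ℝ) * c) ^ 2) ^ 2 + 5 * (d : ℝ) ^ 2 * c ^ 2) * (max (40 * (2 * (1 + CDs))) (64 + 40 * (2 * (CDs' + (d : ℝ) * c * 64)))))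
    -- leaf-01-g9's `eH`, `e₂`, `ε⋆` at the taxi sizes, and `δ′`
    let eH : (ℕ → ℝ) → ℕ → ℝ := fun a k => (((d : ℝ) / 4 + 1 / 2) * ((L : ℝ) / ((L ^ k : ℕ) : ℝ) ^ 2)) * CRc a k * (Λcol a k + 1)
        + 2 * (Real.sqrt (2 * d * (1 + (d : ℝ) ^ 2)) * (((L ^ k : ℕ) : ℝ) * L * (((d - 1 : ℕ) : ℝ) * ((L - 1 : ℕ) : ℝ) * ((2 * L - 1 : ℕ) : ℝ) * b k)))
          * Real.sqrt ((Λcol a k + (((d : ℝ) / 4 + 1 / 2) * ((L : ℝ) / ((L ^ k : ℕ) : ℝ) ^ 2)) * CRc a k * (Λcol a k + 1)) * (136 * (Λcol a k + 1)))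
        + (Real.sqrt (2 * d * (1 + (d : ℝ) ^ 2)) * (((L ^ k : ℕ) : ℝ) * L * (((d - 1 : ℕ) : ℝ) * ((L - 1 : ℕ) : ℝ) * ((2 * L - 1 : ℕ) : ℝ) * b k))) ^ 2 * (136 * (Λcol a k + 1))
        + 2 * (Real.sqrt d * (((L ^ k : ℕ) : ℝ) * (((d - 1 : ℕ) : ℝ) * L * ((L - 1 : ℕ) : ℝ) * b k))) * Real.sqrt (Λcol a k * (136 * (Λcol a k + 1)))
    let e₂ : (ℕ → ℝ) → ℕ → ℝ := fun a k => t k + 3 * (1 + (t k)⁻¹) * (8 * d * ((((L ^ k : ℕ) : ℝ) ^ 2)⁻¹ * CRv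
          + (1 + (((d - 1 : ℕ) : ℝ) * ((L - 1 : ℕ) : ℝ) * ((2 * L - 1 : ℕ) : ℝ) * b k)) ^ 2 * ((d : ℝ) / 4 * L * ((((L ^ k : ℕ) : ℝ) ^ 2)⁻¹ * CRv)) + (((d - 1 : ℕ) : ℝ) * ((L - 1 : ℕ) : ℝ) * ((2 * L - 1 : ℕ) : ℝ) * b k) ^ 2 * ((2 * (1 + CDs)) + CGar' a k)
          + (((d - 1 : ℕ) : ℝ) * ((L - 1 : ℕ) : ℝ) * ((2 * L - 1 : ℕ) : ℝ) * b k) ^ 2 * (2 * (1 + (d : ℝ) ^ 2) * (L : ℝ) ^ 2 * (((L ^ k : ℕ) : ℝ) ^ 2 * CPv a k)))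
        + (d : ℝ) / 2 * (2 * d * ((((L ^ k : ℕ) : ℝ) ^ 2)⁻¹ * CRv) + 2 * (d : ℝ) ^ 2 * a k ^ 2 * (((L ^ k : ℕ) : ℝ) ^ 2 * CPv a k))
        + (d : ℝ) / 4 * (2 * (2 * d * ((((L ^ k : ℕ) : ℝ) ^ 2)⁻¹ * CRv) + 2 * (d : ℝ) ^ 2 * a k ^ 2 * (((L ^ k : ℕ) : ℝ) ^ 2 * CPv a k)) + 2 * (Λcol a k * (((L ^ k : ℕ) : ℝ) ^ 2)⁻¹ * (CDs + CDs')))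
        + 136 * eH a k * (CDs + CDs'))
    let εs : (ℕ → ℝ) → ℕ → ℝ := fun a k => u k + (1 + u k) * ((s k + (1 + (s k)⁻¹) * (d * (L : ℝ) / ((L ^ k : ℕ) : ℝ) ^ 2)) * (1 + CRv) + e₂ a k)
      + (1 + (u k)⁻¹) * (Λv a k * (25 / 4 * ((((L ^ k : ℕ) : ℝ) ^ 2)⁻¹ * ((2 * (1 + CDs)) + CGar' a k))))
    let δ' : ℕ → ℝ := fun k => Real.sqrt (8 * d * (1 + (d : ℝ) ^ 2)) * (((L ^ k : ℕ) : ℝ) * L * (((d - 1 : ℕ) : ℝ) * ((L - 1 : ℕ) : ℝ) * ((2 * L - 1 : ℕ) : ℝ) * b k))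
    -- file 4b's transfer constants
    let v : (ℕ → ℝ) → ℕ → ℝ := fun a k => (1 + (u₂ k)⁻¹) * (4 * ((d : ℝ) * ((d : ℝ) * (((L : ℝ) * ((L ^ k - 1 : ℕ) : ℝ) * ((L - 1 : ℕ) : ℝ)) * b k)))
          * revPC d (L ^ k * L) (((d - 1 : ℕ) : ℝ) * ((L - 1 : ℕ) : ℝ) * ((2 * L - 1 : ℕ) : ℝ) * b k + ((d - 1 : ℕ) : ℝ) * ((L ^ k - 1 : ℕ) : ℝ) * a k)) ^ 2
        * ((d : ℝ) * ((2 * (1 + CDs)) + (2 * (CDs' + d * ((((L ^ (k + 1) : ℕ) : ℝ)) ^ 2 * b k) * 64))))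
    let γ : ℕ → ℝ := fun k => (3 * (((d - 1 : ℕ) : ℝ) * L * ((L - 1 : ℕ) : ℝ) * b k)) ^ 2 * max (40 * (2 * (1 + CDs))) (64 + 40 * (2 * (CDs' + d * ((((L ^ (k + 1) : ℕ) : ℝ)) ^ 2 * b k) * 64)))
    let Λf : ℕ → ℝ := fun k => lamV d ((L ^ (k + 1) : ℕ) * (((d - 1 : ℕ) : ℝ) * ((L ^ (k + 1) - 1 : ℕ) : ℝ) * b k)) d (((L ^ (k + 1) : ℕ) : ℝ) ^ 2 * 0)
          / (1 - (kappaV d (L ^ (k + 1)))⁻¹ * ((∑ q ∈ Finset.range (k + 1), ((((d - 1 : ℕ) : ℝ) + (d : ℝ) * d) * (((L : ℝ) * ((L ^ q - 1 : ℕ) : ℝ) * ((L - 1 : ℕ) : ℝ)) * b q)))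
              + 3 * (((d - 1 : ℕ) : ℝ) * (L ^ (k + 1) : ℕ) * ((L ^ (k + 1) - 1 : ℕ) : ℝ) * b k))) ^ 2
    let A : (ℕ → ℝ) → ℕ → ℝ := fun a k => (1 + w k + (1 + (w k)⁻¹) * (Λf k * γ k) * (1 + 4 * γ k)) * (1 + 4 * v a k) * (1 + u₂ k)
    let B : (ℕ → ℝ) → ℕ → ℝ := fun a k => (1 + w k + (1 + (w k)⁻¹) * (Λf k * γ k) * (1 + 4 * γ k)) * (1 + 4 * v a k) * (4 * v a k) + 4 * ((1 + (w k)⁻¹) * (Λf k * γ k))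
    -- the END's decaying defects
    let ε₁ : (ℕ → ℝ) → ℕ → ℝ := fun a k => (A a k - 1) + A a k * εs a k + B a k
    let δ₁ : (ℕ → ℝ) → ℕ → ℝ := fun a k => Real.sqrt (A a k) * δ' k
    -- the DISPLAYED arithmetic on the explicit sequences, for every class sequence `a`
    (∀ a : ℕ → ℝ, (∀ k, 0 ≤ a k) → (∀ k, (((L ^ k : ℕ)) : ℝ) ^ 2 * a k ≤ c) → ∀ k, v a k ≤ 1 / 8) →
    (∀ k, γ k ≤ 1 / 4) →
    (∀ a : ℕ → ℝ, (∀ k, 0 ≤ a k) → (∀ k, (((L ^ k : ℕ)) : ℝ) ^ 2 * a k ≤ c) → ∀ k, ε₁ a k ≤ cε * θ ^ k) →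
    (∀ a : ℕ → ℝ, (∀ k, 0 ≤ a k) → (∀ k, (((L ^ k : ℕ)) : ℝ) ^ 2 * a k ≤ c) → ∀ k, δ₁ a k ≤ cδ * θ ^ k) →
    ∃ Xlim : Matrix (Tor M × Fin d) (Tor M × Fin d) ℂ,
      Tendsto (fun k => effV (L ^ k) M (Rlev L M R' k)
        (GmProj (fine (L ^ k) M) (Rlev L M R' k) (LinearMap.ker (avgOp (L ^ k) M (taxiTv (L ^ k) M (Rlev L M R' k))))) (QmL (L ^ k) M (nestLv L M R' k)) aa)
        atTop (𝓝 Xlim) ∧ Xlim.IsHermitian ∧ (∀ v, 0 ≤ qform Xlim v) ∧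
      ∀ φ : Tor M → Fin d → ℂ, Tendsto (fun k => blockSpin (QvL (L ^ k) M (nestLv L M R' k))
        (ScV (L ^ k) M (Rlev L M R' k) (projG (fine (L ^ k) M) (Rlev L M R' k) (LinearMap.ker (avgOp (L ^ k) M (taxiTv (L ^ k) M (Rlev L M R' k)))))) φ)
        atTop (𝓝 (qform Xlim (unc φ))) := by
  intro Λc CRc ε₁c δ'c Λcol CPv CGar' Λv CRv eH e₂ εs δ' v γ Λf A B ε₁ δ₁ hv hγ hεθ hδθ
  have hR'all : ∀ k x μ, ‖R' k x μ‖ ≤ 1 := fun k x μ => norm_le_one_of_mem_unitary (hU k x μ)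
  -- elementary signs (no `positivity`: the context is large)
  have hN : ∀ n : ℕ, (0 : ℝ) ≤ n := fun n => Nat.cast_nonneg n
  have hc0 : 0 ≤ c := le_trans (mul_nonneg (sq_nonneg _) (hb0 0)) (hbc 0)
  have hD0 : 0 ≤ (((d - 1 : ℕ) : ℝ) + (d : ℝ) * d) := add_nonneg (hN _) (mul_nonneg (hN _) (hN _))
  have h2 : (0 : ℝ) ≤ 2 := by norm_num
  have hm0 : ∀ k, (0 : ℝ) ≤ (((d - 1 : ℕ) : ℝ) * L * ((L - 1 : ℕ) : ℝ) * b k) := fun k =>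
    mul_nonneg (mul_nonneg (mul_nonneg (hN _) (hN _)) (hN _)) (hb0 k)
  have hm₁0 : ∀ k, (0 : ℝ) ≤ (((d - 1 : ℕ) : ℝ) * ((L - 1 : ℕ) : ℝ) * ((2 * L - 1 : ℕ) : ℝ) * b k) := fun k =>
    mul_nonneg (mul_nonneg (mul_nonneg (hN _) (hN _)) (hN _)) (hb0 k)
  have hCGar0 : (0 : ℝ) ≤ 2 * (1 + CDs) := mul_nonneg h2 (add_nonneg zero_le_one hCDs0)
  have h40 : (0 : ℝ) ≤ 40 * (2 * (1 + CDs)) := mul_nonneg (by norm_num : (0 : ℝ) ≤ 40) hCGar0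
  have hΛs0 : 0 ≤ 4 * lamV d (((d - 1 : ℕ) : ℝ) * c) (d : ℝ) 0 := mul_nonneg (by norm_num : (0 : ℝ) ≤ 4) (lamV_nonneg (hN d) le_rfl)
  have hCPs0 : (0 : ℝ) ≤ max (40 * (2 * (1 + CDs))) (64 + 40 * (2 * (CDs' + (d : ℝ) * c * 64))) := le_max_of_le_left h40
  have hCRv0 : 0 ≤ CRv := by
    simp only [CRv]
    exact add_nonneg (add_nonneg (mul_nonneg (by norm_num : (0 : ℝ) ≤ 8) hΛs0)
      (mul_nonneg (mul_nonneg (mul_nonneg h2 (hN d)) hc0) (add_nonneg hCGar0 (mul_nonneg h2 (add_nonneg hCDs0' (mul_nonneg (mul_nonneg (hN d) hc0) (by norm_num : (0 : ℝ) ≤ 64)))))))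
      (mul_nonneg (add_nonneg (mul_nonneg (by norm_num : (0 : ℝ) ≤ 8) (sq_nonneg _)) (mul_nonneg (mul_nonneg (by norm_num : (0 : ℝ) ≤ 5) (sq_nonneg _)) (sq_nonneg _))) hCPs0)
  -- the class package (plaquette class `a` of the level bonds) with the (GF1′) constants of `projG`: `C_G = d`, `C₀ = 0`
  obtain ⟨a, ha0, ha, hac, hκγ, hsmallP, hγs, -, hΛk⟩ := taxiClassPackage L M hL hd hU hb hbc hsm1 hsm2 hsm3 (CG := fun _ => (d : ℝ)) (C₀ := fun _ => 0)
    (CGs := (d : ℝ)) (c₀ := 0) (fun _ => Nat.cast_nonneg d) (fun _ => le_rfl) (fun _ => le_rfl) (fun _ => by simp)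
  -- part 8's sockets for Bałaban's functional on the tower's carriers (coarse V-UB, (Går), V-P, V-REG), uniform constants
  obtain ⟨hUBcV, -, hPcV, hREGV⟩ := projG_sockets_nestLv L M hd hM2 hU hb hcoh ha0 ha hac hκγ hsmallP hγs hΛk hsm4 hCDs0 hCDs0' hGdiv
  -- the signs of the explicit sequences
  have hΛc0 : ∀ k, 0 ≤ Λc a k := fun k => by
    simp only [Λc]
    exact mul_nonneg (mul_nonneg (mul_nonneg h2 (hN d)) (pow_nonneg (by norm_num : (0 : ℝ) ≤ 36) d)) (add_nonneg (sq_nonneg _) (by norm_num : (0 : ℝ) ≤ 9))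
  have hCRc0 : ∀ k, 0 ≤ CRc a k := fun k => by
    simp only [CRc]
    exact add_nonneg (add_nonneg (mul_nonneg h2 (hΛc0 k)) (mul_nonneg (mul_nonneg h2 (hN d)) (mul_nonneg (ha0 k) (sq_nonneg _))))
      (mul_nonneg (mul_nonneg (sq_nonneg _) (sq_nonneg _)) (by norm_num : (0 : ℝ) ≤ 136))
  have hε₁c0 : ∀ k, 0 ≤ ε₁c k := fun k => by
    simp only [ε₁c]
    exact mul_nonneg (add_nonneg (div_nonneg (hN d) (by norm_num : (0 : ℝ) ≤ 4)) (by norm_num : (0 : ℝ) ≤ 1 / 2)) (div_nonneg (hN L) (sq_nonneg _))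
  have hδ'c0 : ∀ k, 0 ≤ δ'c k := fun k => by
    simp only [δ'c]
    exact mul_nonneg (Real.sqrt_nonneg _) (mul_nonneg (mul_nonneg (hN _) (hN _)) (hm₁0 k))
  have hΛcol0 : ∀ k, 0 ≤ Λcol a k := fun k => by
    simp only [Λcol]
    exact add_nonneg (hΛc0 k) (mul_nonneg (add_nonneg (add_nonneg (mul_nonneg (hε₁c0 k) (hCRc0 k))
      (mul_nonneg (mul_nonneg h2 (hδ'c0 k)) (Real.sqrt_nonneg _))) (mul_nonneg (sq_nonneg _) (by norm_num : (0 : ℝ) ≤ 136))) (add_nonneg (hΛc0 k) zero_le_one))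
  have hCGar'0 : ∀ k, 0 ≤ CGar' a k := fun k => by
    simp only [CGar']
    exact mul_nonneg h2 (add_nonneg hCDs0' (mul_nonneg (mul_nonneg (hN d) (mul_nonneg (sq_nonneg _) (ha0 k))) (by norm_num : (0 : ℝ) ≤ 64)))
  have hCPv0 : ∀ k, 0 ≤ CPv a k := fun k => by
    simp only [CPv]
    exact le_max_of_le_left h40
  have hΛv0 : ∀ k, 0 ≤ Λv a k := fun k => by
    simp only [Λv]
    exact div_nonneg (lamV_nonneg (hN d) (mul_nonneg (sq_nonneg _) le_rfl)) (sq_nonneg _)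
  have hΛf0 : ∀ k, 0 ≤ Λf k := fun k => by
    simp only [Λf]
    exact div_nonneg (lamV_nonneg (hN d) (mul_nonneg (sq_nonneg _) le_rfl)) (sq_nonneg _)
  have hCG1' : ∀ k, (0 : ℝ) ≤ 2 * (CDs' + d * ((((L ^ (k + 1) : ℕ) : ℝ)) ^ 2 * b k) * 64) := fun k =>
    mul_nonneg h2 (add_nonneg hCDs0' (mul_nonneg (mul_nonneg (hN d) (mul_nonneg (sq_nonneg _) (hb0 k))) (by norm_num : (0 : ℝ) ≤ 64)))
  have hv0 : ∀ k, 0 ≤ v a k := fun k => by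
    have h1u : 0 ≤ 1 + (u₂ k)⁻¹ := add_nonneg zero_le_one (inv_nonneg.2 (hu₂ k).le)
    simp only [v]
    exact mul_nonneg (mul_nonneg h1u (sq_nonneg _)) (mul_nonneg (hN d) (add_nonneg hCGar0 (hCG1' k)))
  have hγ0 : ∀ k, 0 ≤ γ k := fun k => by
    simp only [γ]
    exact mul_nonneg (sq_nonneg _) (le_max_of_le_left h40)
  have hA1 : ∀ k, 1 ≤ A a k := fun k => one_le_transferA (hw k) (mul_nonneg (hΛf0 k) (hγ0 k)) (hγ0 k) (hv0 k) (hu₂ k).le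
  have hA0 : ∀ k, 0 ≤ A a k := fun k => zero_le_one.trans (hA1 k)
  have hB0 : ∀ k, 0 ≤ B a k := fun k => by
    have hwi : 0 ≤ (w k)⁻¹ := inv_nonneg.2 (hw k).le
    have hx : 0 ≤ Λf k * γ k := mul_nonneg (hΛf0 k) (hγ0 k)
    have hg4 : 0 ≤ 1 + 4 * γ k := by linarith [hγ0 k]
    have hv4 : 0 ≤ 1 + 4 * v a k := by linarith [hv0 k]
    have hwx : 0 ≤ (1 + (w k)⁻¹) * (Λf k * γ k) := mul_nonneg (by linarith) hx
    have h1 : 0 ≤ 1 + w k + (1 + (w k)⁻¹) * (Λf k * γ k) * (1 + 4 * γ k) := by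
      have := mul_nonneg hwx hg4
      linarith [(hw k).le]
    exact add_nonneg (mul_nonneg (mul_nonneg h1 hv4) (mul_nonneg (by norm_num : (0 : ℝ) ≤ 4) (hv0 k))) (mul_nonneg (by norm_num : (0 : ℝ) ≤ 4) hwx)
  have hεs0 : ∀ k, 0 ≤ εs a k := fun k =>
    epsStar_nonneg (L ^ k) L (p := a k) (CP := 136) (hm0 k) (hm₁0 k) (hΛcol0 k) (by norm_num) (hCRc0 k) (hΛv0 k) hCRv0 (hCPv0 k) hCGar0 (hCGar'0 k)
      hCDs0 hCDs0' (hs k) (ht k) (hu k)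
  have hε₁0 : ∀ k, 0 ≤ ε₁ a k := fun k =>
    add_nonneg (add_nonneg (sub_nonneg.2 (hA1 k)) (mul_nonneg (hA0 k) (hεs0 k))) (hB0 k)
  have hδ'0 : ∀ k, 0 ≤ δ' k := fun k => by
    simp only [δ']
    exact mul_nonneg (Real.sqrt_nonneg _) (mul_nonneg (mul_nonneg (hN _) (hN _)) (hm₁0 k))
  have hδ₁0 : ∀ k, 0 ≤ δ₁ a k := fun k => mul_nonneg (Real.sqrt_nonneg _) (hδ'0 k)
  -- the class arithmetic at level k+1 in the letter `b k`, and at level k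
  have hκinv : ∀ n : ℕ, 0 < n → (kappaV d n)⁻¹ ≤ 60 * (6 : ℝ) ^ (d - 1) := fun n hn => kappaV_inv_le hd hn
  have hκpos : 0 ≤ 60 * (6 : ℝ) ^ (d - 1) := mul_nonneg (by norm_num : (0 : ℝ) ≤ 60) (pow_nonneg (by norm_num : (0 : ℝ) ≤ 6) _)
  have hsum : ∀ k, (∑ q ∈ Finset.range k, ((((d - 1 : ℕ) : ℝ) + (d : ℝ) * d) * (((L : ℝ) * ((L ^ q - 1 : ℕ) : ℝ) * ((L - 1 : ℕ) : ℝ)) * b q))) ≤ 2 * ((((d - 1 : ℕ) : ℝ) + (d : ℝ) * d) * c) := sumDefect_le_of_class (d := d) L hL hb0 hbc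
  have hsum0 : ∀ k, 0 ≤ (∑ q ∈ Finset.range k, ((((d - 1 : ℕ) : ℝ) + (d : ℝ) * d) * (((L : ℝ) * ((L ^ q - 1 : ℕ) : ℝ) * ((L - 1 : ℕ) : ℝ)) * b q))) :=
    fun k => sum_nonneg fun q _ => mul_nonneg hD0 (mul_nonneg (mul_nonneg (mul_nonneg (hN L) (hN _)) (hN _)) (hb0 q))
  have hblk1 : ∀ k, (((L ^ (k + 1) : ℕ)) : ℝ) * (((d - 1 : ℕ) : ℝ) * ((L ^ (k + 1) - 1 : ℕ) : ℝ) * b k) ≤ ((d - 1 : ℕ) : ℝ) * c :=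
    fun k => blockDefect_le_of_class (d := d) L (k + 1) (hb0 k) (hbc k)
  have hlvl1 : ∀ k, 3 * (((d - 1 : ℕ) : ℝ) * (L ^ (k + 1) : ℕ) * ((L ^ (k + 1) - 1 : ℕ) : ℝ) * b k) ≤ 3 * (((d - 1 : ℕ) : ℝ) * c) :=
    fun k => levelDefect_le_of_class (d := d) L (k + 1) (hb0 k) (hbc k)
  have hlvlk : ∀ k, 3 * (((d - 1 : ℕ) : ℝ) * (L ^ k : ℕ) * ((L ^ k - 1 : ℕ) : ℝ) * a k) ≤ 3 * (((d - 1 : ℕ) : ℝ) * c) :=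
    fun k => levelDefect_le_of_class (d := d) L k (ha0 k) (hac k)
  have hsmall1 : ∀ k, 2 * (d : ℝ) * ((((L ^ (k + 1) : ℕ) : ℝ)) * (((d - 1 : ℕ) : ℝ) * ((L ^ (k + 1) - 1 : ℕ) : ℝ) * b k)) ^ 2 ≤ 1 / 2 := fun k => by
    have h0 : 0 ≤ (((L ^ (k + 1) : ℕ)) : ℝ) * (((d - 1 : ℕ) : ℝ) * ((L ^ (k + 1) - 1 : ℕ) : ℝ) * b k) :=
      mul_nonneg (hN _) (mul_nonneg (mul_nonneg (hN _) (hN _)) (hb0 k))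
    have h1 := pow_le_pow_left₀ h0 (hblk1 k) 2
    exact (mul_le_mul_of_nonneg_left h1 (mul_nonneg h2 (hN d))).trans hsm2
  have hsmall80_1 : ∀ k, 2 * 40 * ((d : ℝ) * ((((L ^ (k + 1) : ℕ) : ℝ)) ^ 2 * b k)) ≤ 1 := fun k => by
    have := mul_le_mul_of_nonneg_left (hbc k) (hN d)
    linarith [hsm4]
  have hsmall80k : ∀ k, 2 * 40 * ((d : ℝ) * ((((L ^ k : ℕ) : ℝ)) ^ 2 * a k)) ≤ 1 := fun k => by
    have := mul_le_mul_of_nonneg_left (hac k) (hN d)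
    linarith [hsm4]
  have hc1 : ∀ k, (kappaV d (L ^ (k + 1)))⁻¹ * ((∑ q ∈ Finset.range (k + 1), ((((d - 1 : ℕ) : ℝ) + (d : ℝ) * d) * (((L : ℝ) * ((L ^ q - 1 : ℕ) : ℝ) * ((L - 1 : ℕ) : ℝ)) * b q)))
              + 3 * (((d - 1 : ℕ) : ℝ) * (L ^ (k + 1) : ℕ) * ((L ^ (k + 1) - 1 : ℕ) : ℝ) * b k)) < 1 := fun k => by
    have hκ := hκinv (L ^ (k + 1)) (pow_pos (NeZero.pos L) _)
    have hX : ((∑ q ∈ Finset.range (k + 1), ((((d - 1 : ℕ) : ℝ) + (d : ℝ) * d) * (((L : ℝ) * ((L ^ q - 1 : ℕ) : ℝ) * ((L - 1 : ℕ) : ℝ)) * b q)))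
              + 3 * (((d - 1 : ℕ) : ℝ) * (L ^ (k + 1) : ℕ) * ((L ^ (k + 1) - 1 : ℕ) : ℝ) * b k)) ≤ 2 * ((((d - 1 : ℕ) : ℝ) + (d : ℝ) * d) * c) + 3 * (((d - 1 : ℕ) : ℝ) * c) := add_le_add (hsum (k + 1)) (hlvl1 k)
    have hX0 : 0 ≤ ((∑ q ∈ Finset.range (k + 1), ((((d - 1 : ℕ) : ℝ) + (d : ℝ) * d) * (((L : ℝ) * ((L ^ q - 1 : ℕ) : ℝ) * ((L - 1 : ℕ) : ℝ)) * b q)))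
              + 3 * (((d - 1 : ℕ) : ℝ) * (L ^ (k + 1) : ℕ) * ((L ^ (k + 1) - 1 : ℕ) : ℝ) * b k)) :=
      add_nonneg (hsum0 (k + 1)) (mul_nonneg (by norm_num : (0 : ℝ) ≤ 3) (mul_nonneg (mul_nonneg (mul_nonneg (hN _) (hN _)) (hN _)) (hb0 k)))
    have hnn : 0 ≤ 60 * (6 : ℝ) ^ (d - 1) * (((d - 1 : ℕ) : ℝ) * c) := mul_nonneg hκpos (mul_nonneg (hN _) hc0)
    calc (kappaV d (L ^ (k + 1)))⁻¹ * ((∑ q ∈ Finset.range (k + 1), ((((d - 1 : ℕ) : ℝ) + (d : ℝ) * d) * (((L : ℝ) * ((L ^ q - 1 : ℕ) : ℝ) * ((L - 1 : ℕ) : ℝ)) * b q)))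
              + 3 * (((d - 1 : ℕ) : ℝ) * (L ^ (k + 1) : ℕ) * ((L ^ (k + 1) - 1 : ℕ) : ℝ) * b k))
        ≤ (60 * (6 : ℝ) ^ (d - 1)) * (2 * ((((d - 1 : ℕ) : ℝ) + (d : ℝ) * d) * c) + 3 * (((d - 1 : ℕ) : ℝ) * c)) := mul_le_mul hκ hX hX0 hκpos
      _ = 60 * (6 : ℝ) ^ (d - 1) * ((2 * ((((d - 1 : ℕ) : ℝ) + (d : ℝ) * d)) + 3 * ((d - 1 : ℕ) : ℝ)) * c) := by ring
      _ < 1 := by linarith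
  -- file 5's smallness at level k: `(d−1)(L^k−1)(2L^k−1)a_k ≤ 2(d−1)c`
  have hextra : ∀ k, ((d - 1 : ℕ) : ℝ) * ((L ^ k - 1 : ℕ) : ℝ) * ((2 * L ^ k - 1 : ℕ) : ℝ) * a k ≤ 2 * (((d - 1 : ℕ) : ℝ) * c) := fun k => by
    have h1 : ((L ^ k - 1 : ℕ) : ℝ) ≤ ((L ^ k : ℕ) : ℝ) := by exact_mod_cast Nat.sub_le _ _
    have h2n : 2 * L ^ k - 1 ≤ 2 * L ^ k := Nat.sub_le _ _
    have h2' : ((2 * L ^ k - 1 : ℕ) : ℝ) ≤ 2 * ((L ^ k : ℕ) : ℝ) := by exact_mod_cast h2n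
    have h12 : ((L ^ k - 1 : ℕ) : ℝ) * ((2 * L ^ k - 1 : ℕ) : ℝ) ≤ ((L ^ k : ℕ) : ℝ) * (2 * ((L ^ k : ℕ) : ℝ)) :=
      mul_le_mul h1 h2' (hN _) (hN _)
    have h3 : ((L ^ k - 1 : ℕ) : ℝ) * ((2 * L ^ k - 1 : ℕ) : ℝ) * a k ≤ 2 * ((((L ^ k : ℕ)) : ℝ) ^ 2 * a k) := by
      calc ((L ^ k - 1 : ℕ) : ℝ) * ((2 * L ^ k - 1 : ℕ) : ℝ) * a k ≤ (((L ^ k : ℕ) : ℝ) * (2 * ((L ^ k : ℕ) : ℝ))) * a k :=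
            mul_le_mul_of_nonneg_right h12 (ha0 k)
        _ = 2 * ((((L ^ k : ℕ)) : ℝ) ^ 2 * a k) := by ring
    have h4 := mul_le_mul_of_nonneg_left h3 (hN (d - 1))
    have h5 := mul_le_mul_of_nonneg_left (hac k) (hN (d - 1))
    calc ((d - 1 : ℕ) : ℝ) * ((L ^ k - 1 : ℕ) : ℝ) * ((2 * L ^ k - 1 : ℕ) : ℝ) * a k
        = ((d - 1 : ℕ) : ℝ) * (((L ^ k - 1 : ℕ) : ℝ) * ((2 * L ^ k - 1 : ℕ) : ℝ) * a k) := by ring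
      _ ≤ ((d - 1 : ℕ) : ℝ) * (2 * ((((L ^ k : ℕ)) : ℝ) ^ 2 * a k)) := h4
      _ = 2 * (((d - 1 : ℕ) : ℝ) * ((((L ^ k : ℕ)) : ℝ) ^ 2 * a k)) := by ring
      _ ≤ 2 * (((d - 1 : ℕ) : ℝ) * c) := by linarith [h5]
  have hcF : ∀ k, (kappaV d (L ^ k * L))⁻¹ * ((∑ q ∈ Finset.range k, ((((d - 1 : ℕ) : ℝ) + (d : ℝ) * d) * (((L : ℝ) * ((L ^ q - 1 : ℕ) : ℝ) * ((L - 1 : ℕ) : ℝ)) * b q))) + 3 * (((d - 1 : ℕ) : ℝ) * (L ^ k : ℕ) * ((L ^ k - 1 : ℕ) : ℝ) * a k) + ((d - 1 : ℕ) : ℝ) * ((L ^ k - 1 : ℕ) : ℝ) * ((2 * L ^ k - 1 : ℕ) : ℝ) * a k) < 1 := fun k => by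
    have hκ := hκinv (L ^ k * L) (Nat.mul_pos (pow_pos (NeZero.pos L) _) (NeZero.pos L))
    have hX : ((∑ q ∈ Finset.range k, ((((d - 1 : ℕ) : ℝ) + (d : ℝ) * d) * (((L : ℝ) * ((L ^ q - 1 : ℕ) : ℝ) * ((L - 1 : ℕ) : ℝ)) * b q))) + 3 * (((d - 1 : ℕ) : ℝ) * (L ^ k : ℕ) * ((L ^ k - 1 : ℕ) : ℝ) * a k) + ((d - 1 : ℕ) : ℝ) * ((L ^ k - 1 : ℕ) : ℝ) * ((2 * L ^ k - 1 : ℕ) : ℝ) * a k) ≤ 2 * ((((d - 1 : ℕ) : ℝ) + (d : ℝ) * d) * c) + 3 * (((d - 1 : ℕ) : ℝ) * c) + 2 * (((d - 1 : ℕ) : ℝ) * c) :=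
      add_le_add (add_le_add (hsum k) (hlvlk k)) (hextra k)
    have hX0 : 0 ≤ ((∑ q ∈ Finset.range k, ((((d - 1 : ℕ) : ℝ) + (d : ℝ) * d) * (((L : ℝ) * ((L ^ q - 1 : ℕ) : ℝ) * ((L - 1 : ℕ) : ℝ)) * b q))) + 3 * (((d - 1 : ℕ) : ℝ) * (L ^ k : ℕ) * ((L ^ k - 1 : ℕ) : ℝ) * a k) + ((d - 1 : ℕ) : ℝ) * ((L ^ k - 1 : ℕ) : ℝ) * ((2 * L ^ k - 1 : ℕ) : ℝ) * a k) :=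
      add_nonneg (add_nonneg (hsum0 k) (mul_nonneg (by norm_num : (0 : ℝ) ≤ 3) (mul_nonneg (mul_nonneg (mul_nonneg (hN _) (hN _)) (hN _)) (ha0 k))))
        (mul_nonneg (mul_nonneg (mul_nonneg (hN _) (hN _)) (hN _)) (ha0 k))
    calc (kappaV d (L ^ k * L))⁻¹ * ((∑ q ∈ Finset.range k, ((((d - 1 : ℕ) : ℝ) + (d : ℝ) * d) * (((L : ℝ) * ((L ^ q - 1 : ℕ) : ℝ) * ((L - 1 : ℕ) : ℝ)) * b q))) + 3 * (((d - 1 : ℕ) : ℝ) * (L ^ k : ℕ) * ((L ^ k - 1 : ℕ) : ℝ) * a k) + ((d - 1 : ℕ) : ℝ) * ((L ^ k - 1 : ℕ) : ℝ) * ((2 * L ^ k - 1 : ℕ) : ℝ) * a k)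
        ≤ (60 * (6 : ℝ) ^ (d - 1)) * (2 * ((((d - 1 : ℕ) : ℝ) + (d : ℝ) * d) * c) + 3 * (((d - 1 : ℕ) : ℝ) * c) + 2 * (((d - 1 : ℕ) : ℝ) * c)) :=
          mul_le_mul hκ hX hX0 hκpos
      _ = 60 * (6 : ℝ) ^ (d - 1) * ((2 * ((((d - 1 : ℕ) : ℝ) + (d : ℝ) * d)) + 5 * ((d - 1 : ℕ) : ℝ)) * c) := by ring
      _ < 1 := hsm6
  -- the colour absorptions: `L(L−1)b_k ≤ c`, `L^k·L(L−1)b_k ≤ c`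
  have hLm1 : ((L - 1 : ℕ) : ℝ) ≤ L := by exact_mod_cast Nat.sub_le _ _
  have hpw : ∀ k, (((L ^ k : ℕ) : ℝ)) * L = ((L ^ (k + 1) : ℕ) : ℝ) := fun k => by push_cast; ring
  have h1k : ∀ k, (1 : ℝ) ≤ ((L ^ k : ℕ) : ℝ) := fun k => by exact_mod_cast Nat.one_le_pow _ _ (NeZero.pos L)
  have hLkL : ∀ k, (((L ^ k : ℕ) : ℝ)) * L * ((L - 1 : ℕ) : ℝ) * b k ≤ c := fun k => by
    have hP0 : 0 ≤ (((L ^ k : ℕ) : ℝ)) * L := mul_nonneg (hN _) (hN _)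
    have hle : ((L - 1 : ℕ) : ℝ) ≤ (((L ^ k : ℕ) : ℝ)) * L := by
      calc ((L - 1 : ℕ) : ℝ) ≤ L := hLm1
        _ = 1 * L := (one_mul _).symm
        _ ≤ ((L ^ k : ℕ) : ℝ) * L := mul_le_mul_of_nonneg_right (h1k k) (hN L)
    calc (((L ^ k : ℕ) : ℝ)) * L * ((L - 1 : ℕ) : ℝ) * b k ≤ (((L ^ k : ℕ) : ℝ)) * L * ((((L ^ k : ℕ) : ℝ)) * L) * b k :=
          mul_le_mul_of_nonneg_right (mul_le_mul_of_nonneg_left hle hP0) (hb0 k)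
      _ = (((L ^ (k + 1) : ℕ)) : ℝ) ^ 2 * b k := by rw [← hpw]; ring
      _ ≤ c := hbc k
  have hLb : ∀ k, (L : ℝ) * (((d - 1 : ℕ) : ℝ) * ((L - 1 : ℕ) : ℝ) * b k) ≤ ((d - 1 : ℕ) : ℝ) * c := fun k => by
    have h3 : (L : ℝ) * ((L - 1 : ℕ) : ℝ) * b k ≤ c := by
      calc (L : ℝ) * ((L - 1 : ℕ) : ℝ) * b k = 1 * ((L : ℝ) * ((L - 1 : ℕ) : ℝ) * b k) := (one_mul _).symm
        _ ≤ ((L ^ k : ℕ) : ℝ) * ((L : ℝ) * ((L - 1 : ℕ) : ℝ) * b k) :=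
            mul_le_mul_of_nonneg_right (h1k k) (mul_nonneg (mul_nonneg (hN L) (hN _)) (hb0 k))
        _ = (((L ^ k : ℕ) : ℝ)) * L * ((L - 1 : ℕ) : ℝ) * b k := by ring
        _ ≤ c := hLkL k
    calc (L : ℝ) * (((d - 1 : ℕ) : ℝ) * ((L - 1 : ℕ) : ℝ) * b k) = ((d - 1 : ℕ) : ℝ) * ((L : ℝ) * ((L - 1 : ℕ) : ℝ) * b k) := by ring
      _ ≤ ((d - 1 : ℕ) : ℝ) * c := mul_le_mul_of_nonneg_left h3 (hN _)
  have hsmallL : ∀ k, 2 * (d : ℝ) * ((L : ℝ) * (((d - 1 : ℕ) : ℝ) * ((L - 1 : ℕ) : ℝ) * b k)) ^ 2 ≤ 1 / 2 := fun k => by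
    have h0 : 0 ≤ (L : ℝ) * (((d - 1 : ℕ) : ℝ) * ((L - 1 : ℕ) : ℝ) * b k) := mul_nonneg (hN L) (mul_nonneg (mul_nonneg (hN _) (hN _)) (hb0 k))
    have h1 := pow_le_pow_left₀ h0 (hLb k) 2
    exact (mul_le_mul_of_nonneg_left h1 (mul_nonneg h2 (hN d))).trans hsm2
  have habsorb : ∀ k, 64 * (d : ℝ) * ((((L ^ k : ℕ) : ℝ)) * (((d - 1 : ℕ) : ℝ) * L * ((L - 1 : ℕ) : ℝ) * b k)) ^ 2 ≤ 1 / 2 := fun k => by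
    have h0 : 0 ≤ (((L ^ k : ℕ) : ℝ)) * (((d - 1 : ℕ) : ℝ) * L * ((L - 1 : ℕ) : ℝ) * b k) := mul_nonneg (hN _) (hm0 k)
    have h3 : (((L ^ k : ℕ) : ℝ)) * (((d - 1 : ℕ) : ℝ) * L * ((L - 1 : ℕ) : ℝ) * b k) ≤ ((d - 1 : ℕ) : ℝ) * c := by
      calc (((L ^ k : ℕ) : ℝ)) * (((d - 1 : ℕ) : ℝ) * L * ((L - 1 : ℕ) : ℝ) * b k) = ((d - 1 : ℕ) : ℝ) * ((((L ^ k : ℕ) : ℝ)) * L * ((L - 1 : ℕ) : ℝ) * b k) := by ring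
        _ ≤ ((d - 1 : ℕ) : ℝ) * c := mul_le_mul_of_nonneg_left (hLkL k) (hN _)
    have h4 := pow_le_pow_left₀ h0 h3 2
    exact (mul_le_mul_of_nonneg_left h4 (mul_nonneg (by norm_num : (0 : ℝ) ≤ 64) (hN d))).trans hsm5
  have hρ0 : ∀ k (W : Tor (fine (L ^ k) M) → Fin d → ℂ), 0 ≤ ScV (L ^ k) M (Rlev L M R' k) (projG (fine (L ^ k) M) (Rlev L M R' k) (LinearMap.ker (avgOp (L ^ k) M (taxiTv (L ^ k) M (Rlev L M R' k))))) W + nsqV M (QvL (L ^ k) M (nestLv L M R' k) W) :=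
    fun k W => add_nonneg (ScV_nonneg (L ^ k) M _ (fun W => projG_nonneg _ _ _ W) W) (nsqV_nonneg M _)
  -- leaf-10-g3's monotone END with (ONE-min) := the courier fed by the colour leaves, V-REG for `ρ := ScV + nsqV ∘ Q_k` trivial
  exact effV_tendsto_of_upper_geom L M (Rlev L M R') R' (fun k => GmProj (fine (L ^ k) M) (Rlev L M R' k) (LinearMap.ker (avgOp (L ^ k) M (taxiTv (L ^ k) M (Rlev L M R' k)))))
    (fun k => (projG (fine (L ^ k) M) (Rlev L M R' k) (LinearMap.ker (avgOp (L ^ k) M (taxiTv (L ^ k) M (Rlev L M R' k))))))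
    (fun k => fun W' => (projG (fine (L ^ (k + 1)) M) (Rlev L M R' (k + 1)) (LinearMap.ker (avgOp (L ^ (k + 1)) M (taxiTv (L ^ (k + 1)) M (Rlev L M R' (k + 1)))))) (W' ∘ sites (L ^ k) L M)) (nestLv L M R')
    (fun k => lineT L (fine (L ^ k) M) (taxiTv L (fine (L ^ k) M) (R' k)) (R' k)) (fun k => GmProj_posSemidef _ _ _)
    (fun k W => projG_eq_qform _ _ _ W) (fun k => rfl) (fun k => rfl) (fun k => (Gtr_pullback (L ^ k) L M ((projG (fine (L ^ (k + 1)) M) (Rlev L M R' (k + 1)) (LinearMap.ker (avgOp (L ^ (k + 1)) M (taxiTv (L ^ (k + 1)) M (Rlev L M R' (k + 1)))))))).symm) haa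
    (fun _ => 4 * lamV d (((d - 1 : ℕ) : ℝ) * c) (d : ℝ) 0) (fun _ => max (40 * (2 * (1 + CDs))) (64 + 40 * (2 * (CDs' + (d : ℝ) * c * 64)))) (fun _ => 1) (ε₁ a) (δ₁ a)
    (Λs := 4 * lamV d (((d - 1 : ℕ) : ℝ) * c) (d : ℝ) 0) (CPs := max (40 * (2 * (1 + CDs))) (64 + 40 * (2 * (CDs' + (d : ℝ) * c * 64)))) (CRs := 1)
    (fun _ => hΛs0) (fun _ => le_rfl) (fun _ => hCPs0) (fun _ => le_rfl) (fun _ => zero_le_one) (fun _ => le_rfl) hε₁0 hδ₁0 hθ hθ1 (hεθ a ha0 hac) (hδθ a ha0 hac)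
    (ρV := fun k W => ScV (L ^ k) M (Rlev L M R' k) (projG (fine (L ^ k) M) (Rlev L M R' k) (LinearMap.ker (avgOp (L ^ k) M (taxiTv (L ^ k) M (Rlev L M R' k))))) W + nsqV M (QvL (L ^ k) M (nestLv L M R' k) W))
    hρ0 hUBcV hPcV
    (fun k φ W₀ hW₀ hmin => by
      obtain ⟨hΛ, hCR, hUBc, hUBf, hPc, hPf, hREG⟩ := colour_leaves_taxi L M hU hb hcoh hM2 k (ha0 k) (ha k) (hb0 k) (hsmallP k) (hsmallL k) (habsorb k)
      obtain ⟨g, hg, h⟩ := hONEm_taxi L M hU hb hcoh hd hM2 k (ha0 k) (ha k) (hb0 k) (hsmallP k) (hγs k) (hsmall80k k) (hsmall1 k) (hγs (k + 1)) (hsmall80_1 k)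
        (hc1 k) (hcF k) hCDs0 hCDs0' hCDs0 hCDs0' (hGdiv k) (hGdiv (k + 1)) hΛ (by norm_num) hCR hUBc hUBf hPc hPf hREG hCRv0 (hREGV k)
        (hs k) (ht k) (hu k) (hu₂ k) (hw k) (hv a ha0 hac k) (hγ k) φ W₀ hW₀ hmin
      subst hW₀
      exact ⟨g, hg, h⟩)
    (fun k φ W hW _ => by rw [hW, one_mul])

end Summit.QuantumFields.BalabanUV.T4Continuum.VariationalColourTaxiTransport

end
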